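import Summits.BirchSwinnertonDyer.BirchSwinnertonDyer.Theorems.ManinLocalTwoThreeKLineCongruenceOfBoundedK
import Summits.BirchSwinnertonDyer.BirchSwinnertonDyer.Theorems.ManinLocalTwoThreeKLineMinimalCubeRootAlgInt
import HarnessLib

/-!
# (AN♮)_K IS A THEOREM: the `K`-rational UDC line's analytic node by name (p2's FILE C ∘ p3's (INT)_K)
(route `ManinLocalTwoThree`, crux C3 `ManinPrimeToThreeAtNine` stmt-BirchSwinnertonDyer-22968 — residual RES₃♭, -an g39's `K`-line; C3 LEAD's skeleton v30 stub
(AN♮)_K `stub_kummerCubeRootCongruenceOfBoundedKOfUDC`; cell bsd-f2-manin, prover seat p2 gen 18; `--supports stmt-BirchSwinnertonDyer-22968`)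

* `kummerCubeRootCongruenceOfBoundedKOfUDC_holds : UDCKummerLineK.KummerCubeRootCongruenceOfBoundedKOfUDC` — (AN♮)_K («UDW-algInt at all weights ⟹ every
  `3`-adically bounded normalised cube root of the `K`-rational tangent-line Kummer series is `≡ const (mod 3)`») is the composition of p2's landed glue
  `KLine.kummerCubeRootCongruenceOfBoundedKOfUDC_of_minimalCubeRootK` (p736048: (DICT)_ℂ, (QEXNB)_ℤ̄, the congruence glue; it takes (INT)_K as a hypothesis in
  exactly p3's shape) with p3 g16's (INT)_K `MinimalCubeRootC.exists_algInt_minimalCubeRootC` (his file, resubmitted by p2 for sequencing as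
  `Theorems/ManinLocalTwoThreeKLineMinimalCubeRootAlgInt.lean`);
* `stub_kummerCubeRootCongruenceOfBoundedKOfUDC` — the v30 stub header, verbatim;
* `kummerCubeRootCongruenceOfBoundedK_of_CDT_algInt : CalegariDimitrovTang2025_unboundedDenominators_algInt → UDCKummerLineK.KummerCubeRootCongruenceOfBoundedK` —
  (AN)_K modulo the PRINTED Calegari–Dimitrov–Tang fact only (p2's `KLine.kummerCubeRootCongruenceOfBoundedK_of_CDT_algInt_of_minimalCubeRootK` ∘ (INT)_K).

HONEST FRAMING.  (AN♮)_K is unconditional; (AN)_K is conditional on the printed CDT fact; (BI)_K, KLINE, RES₃♭, C3, Manin's conjecture and BSD are NOT proved.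
Theorem-only file; no sorry, no new axioms. [folklore]
-/

set_option autoImplicit false
-- lint-debt: the directory name repeats the summit name (sibling precedent `ManinLocalTwoThreeKLineCongruenceOfBoundedK.lean`)
set_option linter.dupNamespace false

noncomputable section

open Summit.BirchSwinnertonDyer.Rank1Residual.ManinAdditive.UDCKummerLineK

namespace Summit.BirchSwinnertonDyer.BirchSwinnertonDyer.Theorems.ManinLocalTwoThree.KLine

/-- **(AN♮)_K holds** (p2's glue p736048 ∘ p3's (INT)_K). [folklore] -/
theorem kummerCubeRootCongruenceOfBoundedKOfUDC_holds : KummerCubeRootCongruenceOfBoundedKOfUDC :=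
  kummerCubeRootCongruenceOfBoundedKOfUDC_of_minimalCubeRootK MinimalCubeRootC.exists_algInt_minimalCubeRootC

/-- **The C3 LEAD's v30 stub (AN♮)_K, verbatim header.** [folklore] -/
theorem stub_kummerCubeRootCongruenceOfBoundedKOfUDC : KummerCubeRootCongruenceOfBoundedKOfUDC :=
  kummerCubeRootCongruenceOfBoundedKOfUDC_holds

/-- **(AN)_K modulo the printed Calegari–Dimitrov–Tang fact** (algebraic-integer form). CONDITIONAL on that named fact only. [cite: CalegariDimitrovTang2025, Thm. 1.0.1] -/
theorem kummerCubeRootCongruenceOfBoundedK_of_CDT_algInt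
    (hCDT : Literature.NumberTheory.Automorphic.CalegariDimitrovTang2025_unboundedDenominators_algInt) :
    KummerCubeRootCongruenceOfBoundedK :=
  kummerCubeRootCongruenceOfBoundedK_of_CDT_algInt_of_minimalCubeRootK hCDT MinimalCubeRootC.exists_algInt_minimalCubeRootC

end Summit.BirchSwinnertonDyer.BirchSwinnertonDyer.Theorems.ManinLocalTwoThree.KLine

end
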